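/-
Copyright (c) 2026 the pub-hodgecm-mathlib formalisation cell (harness21).  Prover seat hodgecm-mathlib-K2E4-p14 (g6), Track B ∕ K2-LIT, h413 =
`stmt-HodgeConjecture-24833`, line `K2_E1_TraceFormulaBeta`, campaign «EIS-RANK-ONE» rung R6f(ii); DEAL «MS-FIN-2» ED. 2 of the dealer K2E1-plan (g4) 2026-09-04T06:36:29Z (6)
(«§3 the four facts `hψL1 hi₅ habs habs′` in ED. 6's binder shapes, then ED. 7», reserved for the K2E4-p14 successor; taken 06:43Z).
-/
import Summits.HodgeConjecture.HodgeConjecture.Theorems.K2E1MaassSelbergCMThreePairings   -- ★ p857970 + ED. 2 (this seat): §1 height-only majorants, §2 pointwise bounds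
import HarnessLib

/-!
# K2·E1 — `K2E1MaassSelbergCMThreePairingsFin`: THE FOUR ABSOLUTE-CONVERGENCE INPUTS `hψL1`, `hi₅`, `habs`, `habs′` OF THE MAASS–SELBERG RELATION DISCHARGED, AND ED. 7
# (campaign «EIS-RANK-ONE», rung R6f(ii), deal «MS-FIN-2» ED. 2 of the dealer K2E1-plan (g4) 2026-09-04T06:36:29Z (6): §3 + §4 of the «MS-FIN-2» plan, split off by the 400-line law)

Track B ∕ K2-LIT, crux h413 = `stmt-HodgeConjecture-24833`, route of record `HCCMUnconditional`; cell `hodgecm-mathlib`, squad K2, ENGINE E1.  Prover seat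
`hodgecm-mathlib-K2E4-p14` (g6), successor of (g5).  THEOREMS ONLY (no `def`, no `instance`, no notation, no named-fact hypothesis, no `sorry`); lane
`--supports stmt-HodgeConjecture-24833 --as helper` (count-neutral).  Closes no socket.  Generic quadratic `(F, E, c)`, `[E:F] = 2`, `c² = 1`, `c ≠ 1`.

THE MATHEMATICS [MoeglinWaldspurger1995, II.1.5–II.1.7, IV.2.1–IV.2.3; Garrett2018, §2.8, §11.3].  With `ψ = 𝟙_{H≤T}·f_z − 𝟙_{H>T}·(α_t·H^{2−z})` and the cut-off
`χ = 𝟙_{H>T}·(f′_{z′} + α_t′·H^{2−z′})` (bounded coefficients `φ, α_t, φ′, α_t′`; at `α_t = φ̃ := (M(w₀) f_z)·H^{z−2}`, `α_t′ = φ̃′` these are ★ ED. 6's `ψ`, `χ`), the four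
absolute-convergence inputs of ★ ED. 6 `maassSelberg_flatSectionU_three_fin` are, by ★ ED. 2 §2 (`|ψ| ≤ C_φ𝟙_{H≤T}H^{Re z} + C_t𝟙_{H>T}H^{2−Re z}`,
`∫_u|χ(w₀ug)| ≤ (C_φ′ + C_t′T^{2−2Re z′})·c(Re z′)·H^{2−Re z′}`, `∫_u|ψ(w₀⁻¹ug)| ≤ C_φ·c(Re z)·H^{2−Re z}` on `{H > T}`), dominated by `B(F)`-weighted integrals of HEIGHT-ONLY
weights, finite by ★ ED. 1 §1 at the exponents (sub-tube `2 < Re z′ < Re z`): `hψL1 ↦ (Re z; ≤), (2−Re z; >)`; `hi₅`, `habs ↦ (2−Re z′+Re z; ≤), (4−Re z′−Re z; >)`;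
`habs′ ↦ (Re z′+2−Re z; >)`.
§3 **`lintegral_weight_mul_enorm_psi_lt_top`** (`hψL1`), **`lintegral_weight_mul_enorm_psi_mul_lintegral_chi_lt_top`** (the common core of `hi₅`∕`habs`),
**`lintegral_weight_mul_lintegral_chi_weyl_mul_conj_psi_lt_top`** (`habs`), **`integrable_weight_smul_psi_mul_conj_integral_chi`** (`hi₅`),
**`lintegral_weight_mul_lintegral_chi_mul_conj_psi_weylInv_lt_top`** (`habs′`).
§4 **`maassSelberg_flatSectionU_three_pair`** = ★ ED. 6 with `hψL1`, `hi₅`, `habs`, `habs′` GONE (`α_t = φ̃`, `C_t = C_φ·c(Re z)` by ★ [D8] `norm_intertwinedCoeff_le`).  Remaining named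
inputs of the generic relation: `hfinz`∕`hfinz′`∕`hint′`∕`hsum`, `Λ′` Borel∕`G(F)`-invariant∕bounded (all ★ at CM, see ★ «CM-FINAL»), and the `K_U`-average data `hΞ₁…hΞ₄`.
HONEST LABEL: HC_CM is proved only modulo the 7 printed citations (2 remaining named inputs: hLiu418 = `stmt-HodgeConjecture-24832`, h413 = `stmt-HodgeConjecture-24833`) until rung 0
closes; this file asserts no named fact and closes no socket.
References: [MoeglinWaldspurger1995] II.1.5–II.1.7, IV.2.1–IV.2.3 · [Arthur1980TraceFormulaII] §4 · [Garrett2018] §2.8, §11.3 · [Rogawski1990] §2.2, §7.3.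
-/

set_option autoImplicit false
-- the mandated namespace repeats the single-problem summit's segment (`HodgeConjecture.HodgeConjecture`)
set_option linter.dupNamespace false

noncomputable section

open MeasureTheory Measure NumberField IsDedekindDomain Set MulAction Filter
open scoped ENNReal NNReal ComplexConjugate
open Literature.MeasureTheory.Group Literature.NumberTheory
open Literature.NumberTheory.Automorphic Literature.NumberTheory.Automorphic.UnitaryGroup AdelicGroupData
open Summit.HodgeConjecture.HodgeConjecture.Cruxes.H413.K2E1BorelEisensteinU
open Summit.HodgeConjecture.HodgeConjecture.Cruxes.H413.K2E1MaassSelbergBracketsThree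
open Summit.HodgeConjecture.HodgeConjecture.Cruxes.H413.K2E1IntertwiningGrowthU3
open Summit.HodgeConjecture.HodgeConjecture.Cruxes.H413.K2E1MaassSelbergCMThreePairings
open Summit.HodgeConjecture.HodgeConjecture.Cruxes.H413.K2E1MaassSelbergCMThreeIntertwined (measurable_intertwinedCoeff)

namespace Summit.HodgeConjecture.HodgeConjecture.Cruxes.H413.K2E1MaassSelbergCMThreePairingsFin

variable {F E : Type} [Field F] [NumberField F] [Field E] [NumberField E] [Algebra F E] {c : E ≃ₐ[F] E}
variable [MeasurableSpace (quasiSplit F E c 3).Adelic] [BorelSpace (quasiSplit F E c 3).Adelic]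
variable [MeasurableSpace (AdeleRing (𝓞 E) E)ˣ] [BorelSpace (AdeleRing (𝓞 E) E)ˣ]

/-! ## §3 The four absolute-convergence inputs of ★ ED. 6, discharged for arbitrary bounded coefficients `α_t`, `α_t′` -/

omit [MeasurableSpace (AdeleRing (𝓞 E) E)ˣ] [BorelSpace (AdeleRing (𝓞 E) E)ˣ] in
/-- The `β`-weighted height-only weight `g ↦ β(g)·𝟙_P(H g)·H(g)^σ` is Borel (for Borel `β`, `P`). [folklore] -/
theorem measurable_weight_mul_indicator_rpow_borelHeight {β : (quasiSplit F E c 3).Adelic → ℝ≥0∞} (hβm : Measurable β) {P : Set ℝ≥0} (hP : MeasurableSet P) (σ : ℝ) :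
    Measurable fun g : (quasiSplit F E c 3).Adelic => β g * P.indicator (fun h : ℝ≥0 => ENNReal.ofReal ((h : ℝ) ^ σ)) (borelHeight g) :=
  hβm.mul (((ENNReal.measurable_ofReal.comp (measurable_coe_nnreal_real.pow_const σ)).indicator hP).comp measurable_borelHeight)

/-- **`hψL1` DISCHARGED**: `∫⁻ β·|ψ| dν_G < ∞` for `ψ = 𝟙_{H≤T}·f_z − 𝟙_{H>T}·(α_t·H^{2−z})`, `‖φ‖ ≤ C_φ`, `‖α_t‖ ≤ C_t`, `Re z > 2`, `T > 0` — ★ ED. 2 `enorm_psi_le` and ★ ED. 1 §1 at the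
exponents `(Re z; ≤)`, `(2 − Re z; >)`. [cite: MoeglinWaldspurger1995, II.1.5 and IV.2.3] [cite: Garrett2018, §11.3] -/
theorem lintegral_weight_mul_enorm_psi_lt_top (h2 : Module.finrank F E = 2) (hc : c * c = 1) (hc1 : c ≠ 1)
    (νG : Measure (quasiSplit F E c 3).Adelic) [νG.IsHaarMeasure]
    (μK : Measure ((standardMaximalCompactGL 3 E).comap (adelicVal F E c 3 ((StdForm.antidiagonal 3).over E)) : Subgroup (quasiSplit F E c 3).Adelic))
    [μK.IsHaarMeasure]
    (νI : Measure (AdeleRing (𝓞 E) E)ˣ) [νI.IsHaarMeasure]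
    (hBK : ∀ g : (quasiSplit F E c 3).Adelic, ∃ b ∈ borelAdelic F E c 3, ∃ k : (quasiSplit F E c 3).Adelic, adelicVal F E c 3 ((StdForm.antidiagonal 3).over E) k ∈ standardMaximalCompactGL 3 E ∧ g = b * k)
    {𝓕I : Set (AdeleRing (𝓞 E) E)ˣ} (h𝓕I : IsIdeleClassDomain E 𝓕I)
    {β : (quasiSplit F E c 3).Adelic → ℝ≥0∞} (hβ : IsCoveringWeight ((arithmeticBorel F E c 3).map (quasiSplit F E c 3).arithmeticSubgroup.subtype) β) {T : ℝ≥0} (hT0 : 0 < T)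
    {φ αt : (quasiSplit F E c 3).Adelic → ℂ} {Cφ Ct : ℝ} (hφC : ∀ x, ‖φ x‖ ≤ Cφ) (hCt : ∀ x, ‖αt x‖ ≤ Ct) {z : ℂ} (hz : 2 < z.re) :
    ∫⁻ g, β g * ‖{y : (quasiSplit F E c 3).Adelic | borelHeight y ≤ T}.indicator (flatSectionU φ z) g - {y : (quasiSplit F E c 3).Adelic | T < borelHeight y}.indicator (flatSectionU αt (2 - z)) g‖ₑ ∂νG < ∞ := by
  have hpt : ∀ g : (quasiSplit F E c 3).Adelic, β g * ‖{y : (quasiSplit F E c 3).Adelic | borelHeight y ≤ T}.indicator (flatSectionU φ z) g - {y : (quasiSplit F E c 3).Adelic | T < borelHeight y}.indicator (flatSectionU αt (2 - z)) g‖ₑ ≤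
      ENNReal.ofReal Cφ * (β g * (Set.Iic T).indicator (fun h : ℝ≥0 => ENNReal.ofReal ((h : ℝ) ^ z.re)) (borelHeight g)) +
        ENNReal.ofReal Ct * (β g * (Set.Ioi T).indicator (fun h : ℝ≥0 => ENNReal.ofReal ((h : ℝ) ^ (2 - z.re))) (borelHeight g)) := fun g =>
    (mul_le_mul_right (enorm_psi_le hφC hCt z T g) (β g)).trans_eq (by ring)
  refine lt_of_le_of_lt (lintegral_mono hpt) ?_
  rw [lintegral_add_left ((measurable_weight_mul_indicator_rpow_borelHeight hβ.measurable measurableSet_Iic _).const_mul _),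
    lintegral_const_mul _ (measurable_weight_mul_indicator_rpow_borelHeight hβ.measurable measurableSet_Iic _),
    lintegral_const_mul _ (measurable_weight_mul_indicator_rpow_borelHeight hβ.measurable measurableSet_Ioi _)]
  exact ENNReal.add_lt_top.2 ⟨ENNReal.mul_lt_top ENNReal.ofReal_lt_top (lintegral_weight_mul_indicator_le_rpow_lt_top h2 hc hc1 νG μK νI hBK h𝓕I hβ hz T),
    ENNReal.mul_lt_top ENNReal.ofReal_lt_top (lintegral_weight_mul_indicator_lt_rpow_lt_top h2 hc hc1 νG μK νI hBK h𝓕I hβ (by linarith) hT0)⟩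

/-- **THE COMMON CORE OF `hi₅` AND `habs`**: `∫⁻ β(g)·|ψ(g)|·(∫⁻_u |χ(w₀ u g)| dν) dν_G(g) < ∞` on the sub-tube `2 < Re z′ < Re z` — ★ ED. 2 `enorm_psi_le` times ★ ED. 2
`lintegral_enorm_chi_weylLongU_mul_le` (Godement finiteness of `H^{z′}` at every `g`), merged by ★ `ofReal_rpow_mul_indicator_rpow_borelHeight` into height-only weights at the exponents
`(2 − Re z′ + Re z; ≤)` (`> 2` iff `Re z′ < Re z`) and `(2 − Re z′ + (2 − Re z); >)` (`< 2`), finite by ★ ED. 1 §1. [cite: MoeglinWaldspurger1995, II.1.5–II.1.6 and IV.2.3] [cite: Garrett2018, §11.3] -/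
theorem lintegral_weight_mul_enorm_psi_mul_lintegral_chi_lt_top (h2 : Module.finrank F E = 2) (hc : c * c = 1) (hc1 : c ≠ 1)
    (νG : Measure (quasiSplit F E c 3).Adelic) [νG.IsHaarMeasure]
    (μK : Measure ((standardMaximalCompactGL 3 E).comap (adelicVal F E c 3 ((StdForm.antidiagonal 3).over E)) : Subgroup (quasiSplit F E c 3).Adelic))
    [μK.IsHaarMeasure]
    (νI : Measure (AdeleRing (𝓞 E) E)ˣ) [νI.IsHaarMeasure]
    (hBK : ∀ g : (quasiSplit F E c 3).Adelic, ∃ b ∈ borelAdelic F E c 3, ∃ k : (quasiSplit F E c 3).Adelic, adelicVal F E c 3 ((StdForm.antidiagonal 3).over E) k ∈ standardMaximalCompactGL 3 E ∧ g = b * k)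
    {𝓕I : Set (AdeleRing (𝓞 E) E)ˣ} (h𝓕I : IsIdeleClassDomain E 𝓕I)
    (ν : Measure ↥(adelicUnipotent F E c 3)) [ν.IsHaarMeasure] [ν.IsInvInvariant]
    {𝓕 : Set ↥(adelicUnipotent F E c 3)} (h𝓕N : IsFundamentalDomain ↥(rationalUnipotent F E c 3) 𝓕 ν)
    {β : (quasiSplit F E c 3).Adelic → ℝ≥0∞} (hβ : IsCoveringWeight ((arithmeticBorel F E c 3).map (quasiSplit F E c 3).arithmeticSubgroup.subtype) β) {T : ℝ≥0} (hT0 : 0 < T)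
    {φ αt φ' αt' : (quasiSplit F E c 3).Adelic → ℂ} {Cφ Ct Cφ' Ct' : ℝ} (hφC : ∀ x, ‖φ x‖ ≤ Cφ) (hCt : ∀ x, ‖αt x‖ ≤ Ct) (hφ'C : ∀ x, ‖φ' x‖ ≤ Cφ') (hCt' : ∀ x, ‖αt' x‖ ≤ Ct')
    {z z' : ℂ} (hz' : 2 < z'.re) (hzz' : z'.re < z.re)
    (hfinz' : ∀ g : (quasiSplit F E c 3).Adelic, ∫⁻ u in 𝓕, (∑' q : (quasiSplit F E c 3).quotientSubgroup ⧸ (borelAdelic F E c 3).subgroupOf (quasiSplit F E c 3).quotientSubgroup,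
        ‖flatSectionU (fun _ : (quasiSplit F E c 3).Adelic => (1 : ℂ)) z' ((((q.out : (quasiSplit F E c 3).quotientSubgroup) : (quasiSplit F E c 3).Adelic))⁻¹ * (u : (quasiSplit F E c 3).Adelic) * g)‖ₑ) ∂ν < ∞) :
    ∫⁻ g, β g * (‖{y : (quasiSplit F E c 3).Adelic | borelHeight y ≤ T}.indicator (flatSectionU φ z) g - {y : (quasiSplit F E c 3).Adelic | T < borelHeight y}.indicator (flatSectionU αt (2 - z)) g‖ₑ * ∫⁻ u : ↥(adelicUnipotent F E c 3), ‖{y : (quasiSplit F E c 3).Adelic | T < borelHeight y}.indicator (flatSectionU φ' z' + flatSectionU αt' (2 - z')) ((quasiSplit F E c 3).toAdelic (weylLongU (c : E →+* E) (rfl : (StdForm.antidiagonal 3).over E = (StdForm.antidiagonal 3).over E)) * ((u : (quasiSplit F E c 3).Adelic) * g))‖ₑ ∂ν) ∂νG < ∞ := by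
  have hpt : ∀ g : (quasiSplit F E c 3).Adelic, β g * (‖{y : (quasiSplit F E c 3).Adelic | borelHeight y ≤ T}.indicator (flatSectionU φ z) g - {y : (quasiSplit F E c 3).Adelic | T < borelHeight y}.indicator (flatSectionU αt (2 - z)) g‖ₑ * ∫⁻ u : ↥(adelicUnipotent F E c 3), ‖{y : (quasiSplit F E c 3).Adelic | T < borelHeight y}.indicator (flatSectionU φ' z' + flatSectionU αt' (2 - z')) ((quasiSplit F E c 3).toAdelic (weylLongU (c : E →+* E) (rfl : (StdForm.antidiagonal 3).over E = (StdForm.antidiagonal 3).over E)) * ((u : (quasiSplit F E c 3).Adelic) * g))‖ₑ ∂ν) ≤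
      ENNReal.ofReal (Cφ' + Ct' * (T : ℝ) ^ (2 - 2 * z'.re)) * ENNReal.ofReal (∫ v : ↥(adelicUnipotent F E c 3), (borelHeight ((quasiSplit F E c 3).toAdelic (weylLongU (c : E →+* E) (rfl : (StdForm.antidiagonal 3).over E = (StdForm.antidiagonal 3).over E)) * (v : (quasiSplit F E c 3).Adelic)) : ℝ) ^ z'.re ∂ν) * ENNReal.ofReal Cφ *
          (β g * (Set.Iic T).indicator (fun h : ℝ≥0 => ENNReal.ofReal ((h : ℝ) ^ (2 - z'.re + z.re))) (borelHeight g)) +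
        ENNReal.ofReal (Cφ' + Ct' * (T : ℝ) ^ (2 - 2 * z'.re)) * ENNReal.ofReal (∫ v : ↥(adelicUnipotent F E c 3), (borelHeight ((quasiSplit F E c 3).toAdelic (weylLongU (c : E →+* E) (rfl : (StdForm.antidiagonal 3).over E = (StdForm.antidiagonal 3).over E)) * (v : (quasiSplit F E c 3).Adelic)) : ℝ) ^ z'.re ∂ν) * ENNReal.ofReal Ct *
          (β g * (Set.Ioi T).indicator (fun h : ℝ≥0 => ENNReal.ofReal ((h : ℝ) ^ (2 - z'.re + (2 - z.re)))) (borelHeight g)) := by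
    intro g
    have hψ := enorm_psi_le hφC hCt z T g
    have hχ := lintegral_enorm_chi_weylLongU_mul_le hc hc1 ν hBK h𝓕N hφ'C hCt' hT0 (by linarith : 1 ≤ z'.re) g (hfinz' g)
    calc β g * (‖{y : (quasiSplit F E c 3).Adelic | borelHeight y ≤ T}.indicator (flatSectionU φ z) g - {y : (quasiSplit F E c 3).Adelic | T < borelHeight y}.indicator (flatSectionU αt (2 - z)) g‖ₑ * ∫⁻ u : ↥(adelicUnipotent F E c 3), ‖{y : (quasiSplit F E c 3).Adelic | T < borelHeight y}.indicator (flatSectionU φ' z' + flatSectionU αt' (2 - z')) ((quasiSplit F E c 3).toAdelic (weylLongU (c : E →+* E) (rfl : (StdForm.antidiagonal 3).over E = (StdForm.antidiagonal 3).over E)) * ((u : (quasiSplit F E c 3).Adelic) * g))‖ₑ ∂ν)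
        ≤ β g * ((ENNReal.ofReal Cφ * (Set.Iic T).indicator (fun h : ℝ≥0 => ENNReal.ofReal ((h : ℝ) ^ z.re)) (borelHeight g) +
            ENNReal.ofReal Ct * (Set.Ioi T).indicator (fun h : ℝ≥0 => ENNReal.ofReal ((h : ℝ) ^ (2 - z.re))) (borelHeight g)) *
            (ENNReal.ofReal (Cφ' + Ct' * (T : ℝ) ^ (2 - 2 * z'.re)) * ENNReal.ofReal (∫ v : ↥(adelicUnipotent F E c 3), (borelHeight ((quasiSplit F E c 3).toAdelic (weylLongU (c : E →+* E) (rfl : (StdForm.antidiagonal 3).over E = (StdForm.antidiagonal 3).over E)) * (v : (quasiSplit F E c 3).Adelic)) : ℝ) ^ z'.re ∂ν) * ENNReal.ofReal ((borelHeight g : ℝ) ^ (2 - z'.re)))) :=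
          mul_le_mul_right (mul_le_mul' hψ hχ) _
      _ = ENNReal.ofReal (Cφ' + Ct' * (T : ℝ) ^ (2 - 2 * z'.re)) * ENNReal.ofReal (∫ v : ↥(adelicUnipotent F E c 3), (borelHeight ((quasiSplit F E c 3).toAdelic (weylLongU (c : E →+* E) (rfl : (StdForm.antidiagonal 3).over E = (StdForm.antidiagonal 3).over E)) * (v : (quasiSplit F E c 3).Adelic)) : ℝ) ^ z'.re ∂ν) * ENNReal.ofReal Cφ *
            (β g * (ENNReal.ofReal ((borelHeight g : ℝ) ^ (2 - z'.re)) * (Set.Iic T).indicator (fun h : ℝ≥0 => ENNReal.ofReal ((h : ℝ) ^ z.re)) (borelHeight g))) +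
          ENNReal.ofReal (Cφ' + Ct' * (T : ℝ) ^ (2 - 2 * z'.re)) * ENNReal.ofReal (∫ v : ↥(adelicUnipotent F E c 3), (borelHeight ((quasiSplit F E c 3).toAdelic (weylLongU (c : E →+* E) (rfl : (StdForm.antidiagonal 3).over E = (StdForm.antidiagonal 3).over E)) * (v : (quasiSplit F E c 3).Adelic)) : ℝ) ^ z'.re ∂ν) * ENNReal.ofReal Ct *
            (β g * (ENNReal.ofReal ((borelHeight g : ℝ) ^ (2 - z'.re)) * (Set.Ioi T).indicator (fun h : ℝ≥0 => ENNReal.ofReal ((h : ℝ) ^ (2 - z.re))) (borelHeight g))) := by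
          ring
      _ = _ := by rw [ofReal_rpow_mul_indicator_rpow_borelHeight, ofReal_rpow_mul_indicator_rpow_borelHeight]
  refine lt_of_le_of_lt (lintegral_mono hpt) ?_
  rw [lintegral_add_left ((measurable_weight_mul_indicator_rpow_borelHeight hβ.measurable measurableSet_Iic _).const_mul _),
    lintegral_const_mul _ (measurable_weight_mul_indicator_rpow_borelHeight hβ.measurable measurableSet_Iic _),
    lintegral_const_mul _ (measurable_weight_mul_indicator_rpow_borelHeight hβ.measurable measurableSet_Ioi _)]
  exact ENNReal.add_lt_top.2
    ⟨ENNReal.mul_lt_top (ENNReal.mul_lt_top (ENNReal.mul_lt_top ENNReal.ofReal_lt_top ENNReal.ofReal_lt_top) ENNReal.ofReal_lt_top)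
        (lintegral_weight_mul_indicator_le_rpow_lt_top h2 hc hc1 νG μK νI hBK h𝓕I hβ (by linarith) T),
      ENNReal.mul_lt_top (ENNReal.mul_lt_top (ENNReal.mul_lt_top ENNReal.ofReal_lt_top ENNReal.ofReal_lt_top) ENNReal.ofReal_lt_top)
        (lintegral_weight_mul_indicator_lt_rpow_lt_top h2 hc hc1 νG μK νI hBK h𝓕I hβ (by linarith) hT0)⟩

/-- **`habs` DISCHARGED** (★ p857605's absolute convergence, `h := χ`, `F := ψ`): `∫⁻ β(g) ∫⁻_u |χ(w₀ u g)·conj ψ(g)| dν dν_G < ∞` on the sub-tube `2 < Re z′ < Re z` — the common core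
after `|χ·conj ψ| = |χ|·|ψ|`. [cite: MoeglinWaldspurger1995, II.1.5–II.1.6 and IV.2.3] [cite: Arthur1980TraceFormulaII, §4] -/
theorem lintegral_weight_mul_lintegral_chi_weyl_mul_conj_psi_lt_top (h2 : Module.finrank F E = 2) (hc : c * c = 1) (hc1 : c ≠ 1)
    (νG : Measure (quasiSplit F E c 3).Adelic) [νG.IsHaarMeasure]
    (μK : Measure ((standardMaximalCompactGL 3 E).comap (adelicVal F E c 3 ((StdForm.antidiagonal 3).over E)) : Subgroup (quasiSplit F E c 3).Adelic))
    [μK.IsHaarMeasure]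
    (νI : Measure (AdeleRing (𝓞 E) E)ˣ) [νI.IsHaarMeasure]
    (hBK : ∀ g : (quasiSplit F E c 3).Adelic, ∃ b ∈ borelAdelic F E c 3, ∃ k : (quasiSplit F E c 3).Adelic, adelicVal F E c 3 ((StdForm.antidiagonal 3).over E) k ∈ standardMaximalCompactGL 3 E ∧ g = b * k)
    {𝓕I : Set (AdeleRing (𝓞 E) E)ˣ} (h𝓕I : IsIdeleClassDomain E 𝓕I)
    (ν : Measure ↥(adelicUnipotent F E c 3)) [ν.IsHaarMeasure] [ν.IsInvInvariant]
    {𝓕 : Set ↥(adelicUnipotent F E c 3)} (h𝓕N : IsFundamentalDomain ↥(rationalUnipotent F E c 3) 𝓕 ν)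
    {β : (quasiSplit F E c 3).Adelic → ℝ≥0∞} (hβ : IsCoveringWeight ((arithmeticBorel F E c 3).map (quasiSplit F E c 3).arithmeticSubgroup.subtype) β) {T : ℝ≥0} (hT0 : 0 < T)
    {φ αt φ' αt' : (quasiSplit F E c 3).Adelic → ℂ} {Cφ Ct Cφ' Ct' : ℝ} (hφC : ∀ x, ‖φ x‖ ≤ Cφ) (hCt : ∀ x, ‖αt x‖ ≤ Ct) (hφ'C : ∀ x, ‖φ' x‖ ≤ Cφ') (hCt' : ∀ x, ‖αt' x‖ ≤ Ct')
    {z z' : ℂ} (hz' : 2 < z'.re) (hzz' : z'.re < z.re)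
    (hfinz' : ∀ g : (quasiSplit F E c 3).Adelic, ∫⁻ u in 𝓕, (∑' q : (quasiSplit F E c 3).quotientSubgroup ⧸ (borelAdelic F E c 3).subgroupOf (quasiSplit F E c 3).quotientSubgroup,
        ‖flatSectionU (fun _ : (quasiSplit F E c 3).Adelic => (1 : ℂ)) z' ((((q.out : (quasiSplit F E c 3).quotientSubgroup) : (quasiSplit F E c 3).Adelic))⁻¹ * (u : (quasiSplit F E c 3).Adelic) * g)‖ₑ) ∂ν < ∞) :
    ∫⁻ g, β g * ∫⁻ u : ↥(adelicUnipotent F E c 3), ‖{y : (quasiSplit F E c 3).Adelic | T < borelHeight y}.indicator (flatSectionU φ' z' + flatSectionU αt' (2 - z')) ((quasiSplit F E c 3).toAdelic (weylLongU (c : E →+* E) (rfl : (StdForm.antidiagonal 3).over E = (StdForm.antidiagonal 3).over E)) * ((u : (quasiSplit F E c 3).Adelic) * g)) * conj ({y : (quasiSplit F E c 3).Adelic | borelHeight y ≤ T}.indicator (flatSectionU φ z) g - {y : (quasiSplit F E c 3).Adelic | T < borelHeight y}.indicator (flatSectionU αt (2 - z)) g)‖ₑ ∂ν ∂νG < ∞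 := by
  refine lt_of_le_of_lt (le_of_eq (lintegral_congr fun g => ?_))
    (lintegral_weight_mul_enorm_psi_mul_lintegral_chi_lt_top h2 hc hc1 νG μK νI hBK h𝓕I ν h𝓕N hβ hT0 hφC hCt hφ'C hCt' hz' hzz' hfinz')
  simp_rw [enorm_mul, RCLike.enorm_conj]
  rw [lintegral_mul_const' _ _ enorm_ne_top, mul_comm (∫⁻ u : ↥(adelicUnipotent F E c 3), _ ∂ν)]

/-- **`hi₅` DISCHARGED**: `g ↦ β(g)·ψ(g)·conj(∫_u χ(w₀ u g) dν)` is `ν_G`-integrable on the sub-tube `2 < Re z′ < Re z` (Borel coefficients): Borel by ★ ED. 2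
`measurable_integral_weylLongU_mul` (parametric Bochner), and `|β·ψ·conj ∫χ| ≤ β·|ψ|·∫⁻|χ|` (`β.toReal ≤ β`, `|∫χ| ≤ ∫⁻|χ|`) is the common core. [cite: MoeglinWaldspurger1995, IV.2.3]
[cite: Arthur1980TraceFormulaII, §4] -/
theorem integrable_weight_smul_psi_mul_conj_integral_chi (h2 : Module.finrank F E = 2) (hc : c * c = 1) (hc1 : c ≠ 1)
    (νG : Measure (quasiSplit F E c 3).Adelic) [νG.IsHaarMeasure]
    (μK : Measure ((standardMaximalCompactGL 3 E).comap (adelicVal F E c 3 ((StdForm.antidiagonal 3).over E)) : Subgroup (quasiSplit F E c 3).Adelic))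
    [μK.IsHaarMeasure]
    (νI : Measure (AdeleRing (𝓞 E) E)ˣ) [νI.IsHaarMeasure]
    (hBK : ∀ g : (quasiSplit F E c 3).Adelic, ∃ b ∈ borelAdelic F E c 3, ∃ k : (quasiSplit F E c 3).Adelic, adelicVal F E c 3 ((StdForm.antidiagonal 3).over E) k ∈ standardMaximalCompactGL 3 E ∧ g = b * k)
    {𝓕I : Set (AdeleRing (𝓞 E) E)ˣ} (h𝓕I : IsIdeleClassDomain E 𝓕I)
    (ν : Measure ↥(adelicUnipotent F E c 3)) [ν.IsHaarMeasure] [ν.IsInvInvariant]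
    {𝓕 : Set ↥(adelicUnipotent F E c 3)} (h𝓕N : IsFundamentalDomain ↥(rationalUnipotent F E c 3) 𝓕 ν)
    {β : (quasiSplit F E c 3).Adelic → ℝ≥0∞} (hβ : IsCoveringWeight ((arithmeticBorel F E c 3).map (quasiSplit F E c 3).arithmeticSubgroup.subtype) β) {T : ℝ≥0} (hT0 : 0 < T)
    {φ αt φ' αt' : (quasiSplit F E c 3).Adelic → ℂ} (hφm : Measurable φ) (hαtm : Measurable αt) (hφ'm : Measurable φ') (hαt'm : Measurable αt')
    {Cφ Ct Cφ' Ct' : ℝ} (hφC : ∀ x, ‖φ x‖ ≤ Cφ) (hCt : ∀ x, ‖αt x‖ ≤ Ct) (hφ'C : ∀ x, ‖φ' x‖ ≤ Cφ') (hCt' : ∀ x, ‖αt' x‖ ≤ Ct')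
    {z z' : ℂ} (hz' : 2 < z'.re) (hzz' : z'.re < z.re)
    (hfinz' : ∀ g : (quasiSplit F E c 3).Adelic, ∫⁻ u in 𝓕, (∑' q : (quasiSplit F E c 3).quotientSubgroup ⧸ (borelAdelic F E c 3).subgroupOf (quasiSplit F E c 3).quotientSubgroup,
        ‖flatSectionU (fun _ : (quasiSplit F E c 3).Adelic => (1 : ℂ)) z' ((((q.out : (quasiSplit F E c 3).quotientSubgroup) : (quasiSplit F E c 3).Adelic))⁻¹ * (u : (quasiSplit F E c 3).Adelic) * g)‖ₑ) ∂ν < ∞) :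
    Integrable (fun g => (β g).toReal • (({y : (quasiSplit F E c 3).Adelic | borelHeight y ≤ T}.indicator (flatSectionU φ z) g - {y : (quasiSplit F E c 3).Adelic | T < borelHeight y}.indicator (flatSectionU αt (2 - z)) g) * conj (∫ u : ↥(adelicUnipotent F E c 3), {y : (quasiSplit F E c 3).Adelic | T < borelHeight y}.indicator (flatSectionU φ' z' + flatSectionU αt' (2 - z')) ((quasiSplit F E c 3).toAdelic (weylLongU (c : E →+* E) (rfl : (StdForm.antidiagonal 3).over E = (StdForm.antidiagonal 3).over E)) * ((u : (quasiSplit F E c 3).Adelic) * g)) ∂ν))) νG := by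
  have hSle : MeasurableSet {y : (quasiSplit F E c 3).Adelic | borelHeight y ≤ T} := measurableSet_le measurable_borelHeight measurable_const
  have hSgt : MeasurableSet {y : (quasiSplit F E c 3).Adelic | T < borelHeight y} := measurableSet_lt measurable_const measurable_borelHeight
  have hψm : Measurable fun g : (quasiSplit F E c 3).Adelic => {y : (quasiSplit F E c 3).Adelic | borelHeight y ≤ T}.indicator (flatSectionU φ z) g - {y : (quasiSplit F E c 3).Adelic | T < borelHeight y}.indicator (flatSectionU αt (2 - z)) g :=
    ((measurable_flatSectionU hφm z).indicator hSle).sub ((measurable_flatSectionU hαtm (2 - z)).indicator hSgt)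
  have hχm : Measurable ({y : (quasiSplit F E c 3).Adelic | T < borelHeight y}.indicator (flatSectionU φ' z' + flatSectionU αt' (2 - z'))) :=
    ((measurable_flatSectionU hφ'm z').add (measurable_flatSectionU hαt'm (2 - z'))).indicator hSgt
  refine ⟨(hβ.measurable.ennreal_toReal.smul (hψm.mul (Complex.continuous_conj.measurable.comp (measurable_integral_weylLongU_mul ν hχm)))).aestronglyMeasurable, ?_⟩
  rw [hasFiniteIntegral_iff_enorm]
  refine lt_of_le_of_lt (lintegral_mono fun g => ?_)
    (lintegral_weight_mul_enorm_psi_mul_lintegral_chi_lt_top h2 hc hc1 νG μK νI hBK h𝓕I ν h𝓕N hβ hT0 hφC hCt hφ'C hCt' hz' hzz' hfinz')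
  rw [enorm_smul, enorm_mul, RCLike.enorm_conj, Real.enorm_eq_ofReal ENNReal.toReal_nonneg]
  exact mul_le_mul' ENNReal.ofReal_toReal_le (mul_le_mul_right (enorm_integral_le_lintegral_enorm _) _)

/-- **`habs′` DISCHARGED**: `∫⁻ β(g) ∫⁻_u |χ(g)·conj ψ(w₀⁻¹ u g)| dν dν_G < ∞` on the sub-tube `2 < Re z′ < Re z` (`T ≥ 1`): `χ(g) ≠ 0` forces `H(g) > T`, where ★ ED. 2
`lintegral_enorm_psi_weylLongU_inv_mul_le` (R6a: `ψ(w₀⁻¹ug) = f_z(w₀ug)`) and `enorm_chi_le` give the height-only weight at the exponent `(Re z′ + (2 − Re z); >)` (`< 2` iff `Re z′ < Re z`),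
finite by ★ ED. 1 §1. [cite: MoeglinWaldspurger1995, II.1.6–II.1.7 and IV.2.3] [cite: Arthur1980TraceFormulaII, §4] -/
theorem lintegral_weight_mul_lintegral_chi_mul_conj_psi_weylInv_lt_top (h2 : Module.finrank F E = 2) (hc : c * c = 1) (hc1 : c ≠ 1)
    (νG : Measure (quasiSplit F E c 3).Adelic) [νG.IsHaarMeasure]
    (μK : Measure ((standardMaximalCompactGL 3 E).comap (adelicVal F E c 3 ((StdForm.antidiagonal 3).over E)) : Subgroup (quasiSplit F E c 3).Adelic))
    [μK.IsHaarMeasure]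
    (νI : Measure (AdeleRing (𝓞 E) E)ˣ) [νI.IsHaarMeasure]
    (hBK : ∀ g : (quasiSplit F E c 3).Adelic, ∃ b ∈ borelAdelic F E c 3, ∃ k : (quasiSplit F E c 3).Adelic, adelicVal F E c 3 ((StdForm.antidiagonal 3).over E) k ∈ standardMaximalCompactGL 3 E ∧ g = b * k)
    {𝓕I : Set (AdeleRing (𝓞 E) E)ˣ} (h𝓕I : IsIdeleClassDomain E 𝓕I)
    (ν : Measure ↥(adelicUnipotent F E c 3)) [ν.IsHaarMeasure] [ν.IsInvInvariant]
    {𝓕 : Set ↥(adelicUnipotent F E c 3)} (h𝓕N : IsFundamentalDomain ↥(rationalUnipotent F E c 3) 𝓕 ν)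
    {β : (quasiSplit F E c 3).Adelic → ℝ≥0∞} (hβ : IsCoveringWeight ((arithmeticBorel F E c 3).map (quasiSplit F E c 3).arithmeticSubgroup.subtype) β) {T : ℝ≥0} (hT : 1 ≤ T)
    {φ : (quasiSplit F E c 3).Adelic → ℂ} (αt : (quasiSplit F E c 3).Adelic → ℂ) {φ' αt' : (quasiSplit F E c 3).Adelic → ℂ} {Cφ Cφ' Ct' : ℝ} (hφC : ∀ x, ‖φ x‖ ≤ Cφ) (hφ'C : ∀ x, ‖φ' x‖ ≤ Cφ') (hCt' : ∀ x, ‖αt' x‖ ≤ Ct')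
    {z z' : ℂ} (hz' : 2 < z'.re) (hzz' : z'.re < z.re)
    (hfinz : ∀ g : (quasiSplit F E c 3).Adelic, ∫⁻ u in 𝓕, (∑' q : (quasiSplit F E c 3).quotientSubgroup ⧸ (borelAdelic F E c 3).subgroupOf (quasiSplit F E c 3).quotientSubgroup,
        ‖flatSectionU (fun _ : (quasiSplit F E c 3).Adelic => (1 : ℂ)) z ((((q.out : (quasiSplit F E c 3).quotientSubgroup) : (quasiSplit F E c 3).Adelic))⁻¹ * (u : (quasiSplit F E c 3).Adelic) * g)‖ₑ) ∂ν < ∞) :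
    ∫⁻ g, β g * ∫⁻ u : ↥(adelicUnipotent F E c 3), ‖{y : (quasiSplit F E c 3).Adelic | T < borelHeight y}.indicator (flatSectionU φ' z' + flatSectionU αt' (2 - z')) g * conj ({y : (quasiSplit F E c 3).Adelic | borelHeight y ≤ T}.indicator (flatSectionU φ z) (((quasiSplit F E c 3).toAdelic (weylLongU (c : E →+* E) (rfl : (StdForm.antidiagonal 3).over E = (StdForm.antidiagonal 3).over E)))⁻¹ * ((u : (quasiSplit F E c 3).Adelic) * g)) - {y : (quasiSplit F E c 3).Adelic | T < borelHeight y}.indicator (flatSectionU αt (2 - z)) (((quasiSplit F E c 3).toAdelic (weylLongU (c : E →+* E) (rfl : (StdForm.antidiagonal 3).over E = (StdForm.antidiagonal 3).over E)))⁻¹ * ((u : (quasiSplit F E c 3).Adelic) * g)))‖ₑ ∂ν ∂νG < ∞ := by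
  have hT0 : 0 < T := lt_of_lt_of_le one_pos hT
  have hpt : ∀ g : (quasiSplit F E c 3).Adelic, β g * ∫⁻ u : ↥(adelicUnipotent F E c 3), ‖{y : (quasiSplit F E c 3).Adelic | T < borelHeight y}.indicator (flatSectionU φ' z' + flatSectionU αt' (2 - z')) g * conj ({y : (quasiSplit F E c 3).Adelic | borelHeight y ≤ T}.indicator (flatSectionU φ z) (((quasiSplit F E c 3).toAdelic (weylLongU (c : E →+* E) (rfl : (StdForm.antidiagonal 3).over E = (StdForm.antidiagonal 3).over E)))⁻¹ * ((u : (quasiSplit F E c 3).Adelic) * g)) - {y : (quasiSplit F E c 3).Adelic | T < borelHeight y}.indicator (flatSectionU αt (2 - z)) (((quasiSplit F E c 3).toAdelic (weylLongU (c : E →+* E) (rfl : (StdForm.antidiagonal 3).over E = (StdForm.antidiagonal 3).over E)))⁻¹ * ((u : (quasiSplit F E c 3).Adelic) * g)))‖ₑ ∂ν ≤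
      ENNReal.ofReal (Cφ' + Ct' * (T : ℝ) ^ (2 - 2 * z'.re)) * ENNReal.ofReal Cφ * ENNReal.ofReal (∫ v : ↥(adelicUnipotent F E c 3), (borelHeight ((quasiSplit F E c 3).toAdelic (weylLongU (c : E →+* E) (rfl : (StdForm.antidiagonal 3).over E = (StdForm.antidiagonal 3).over E)) * (v : (quasiSplit F E c 3).Adelic)) : ℝ) ^ z.re ∂ν) *
        (β g * (Set.Ioi T).indicator (fun h : ℝ≥0 => ENNReal.ofReal ((h : ℝ) ^ (z'.re + (2 - z.re)))) (borelHeight g)) := by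
    intro g
    simp_rw [enorm_mul, RCLike.enorm_conj]
    rw [lintegral_const_mul' _ _ enorm_ne_top]
    by_cases hg : T < borelHeight g
    · have hpos : (0 : ℝ) < (borelHeight g : ℝ) := by exact_mod_cast borelHeight_pos g
      have hχ := enorm_chi_le hφ'C hCt' hT0 (by linarith : 1 ≤ z'.re) g
      have hψ := lintegral_enorm_psi_weylLongU_inv_mul_le hc hc1 ν hBK h𝓕N αt hφC z hT hg (hfinz g)
      calc β g * (‖{y : (quasiSplit F E c 3).Adelic | T < borelHeight y}.indicator (flatSectionU φ' z' + flatSectionU αt' (2 - z')) g‖ₑ * ∫⁻ u : ↥(adelicUnipotent F E c 3), ‖{y : (quasiSplit F E c 3).Adelic | borelHeight y ≤ T}.indicator (flatSectionU φ z) (((quasiSplit F E c 3).toAdelic (weylLongU (c : E →+* E) (rfl : (StdForm.antidiagonal 3).over E = (StdForm.antidiagonal 3).over E)))⁻¹ * ((u : (quasiSplit F E c 3).Adelic) * g)) - {y : (quasiSplit F E c 3).Adelic | T < borelHeight y}.indicator (flatSectionU αt (2 - z)) (((quasiSplit F E c 3).toAdelic (weylLongU (c : E →+* E) (rfl : (StdForm.antidiagonal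 3).over E = (StdForm.antidiagonal 3).over E)))⁻¹ * ((u : (quasiSplit F E c 3).Adelic) * g))‖ₑ ∂ν)
          ≤ β g * ((ENNReal.ofReal (Cφ' + Ct' * (T : ℝ) ^ (2 - 2 * z'.re)) * ENNReal.ofReal ((borelHeight g : ℝ) ^ z'.re)) *
              (ENNReal.ofReal Cφ * ENNReal.ofReal (∫ v : ↥(adelicUnipotent F E c 3), (borelHeight ((quasiSplit F E c 3).toAdelic (weylLongU (c : E →+* E) (rfl : (StdForm.antidiagonal 3).over E = (StdForm.antidiagonal 3).over E)) * (v : (quasiSplit F E c 3).Adelic)) : ℝ) ^ z.re ∂ν) * ENNReal.ofReal ((borelHeight g : ℝ) ^ (2 - z.re)))) := mul_le_mul_right (mul_le_mul' hχ hψ) _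
        _ = ENNReal.ofReal (Cφ' + Ct' * (T : ℝ) ^ (2 - 2 * z'.re)) * ENNReal.ofReal Cφ * ENNReal.ofReal (∫ v : ↥(adelicUnipotent F E c 3), (borelHeight ((quasiSplit F E c 3).toAdelic (weylLongU (c : E →+* E) (rfl : (StdForm.antidiagonal 3).over E = (StdForm.antidiagonal 3).over E)) * (v : (quasiSplit F E c 3).Adelic)) : ℝ) ^ z.re ∂ν) *
              (β g * (ENNReal.ofReal ((borelHeight g : ℝ) ^ z'.re) * ENNReal.ofReal ((borelHeight g : ℝ) ^ (2 - z.re)))) := by ring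
        _ = _ := by
          rw [← ENNReal.ofReal_mul (Real.rpow_nonneg hpos.le _), ← Real.rpow_add hpos, indicator_of_mem (show borelHeight g ∈ Set.Ioi T from hg)]
    · rw [indicator_of_notMem (show g ∉ {y : (quasiSplit F E c 3).Adelic | T < borelHeight y} from hg), enorm_zero, zero_mul, mul_zero]
      exact bot_le
  refine lt_of_le_of_lt (lintegral_mono hpt) ?_
  rw [lintegral_const_mul _ (measurable_weight_mul_indicator_rpow_borelHeight hβ.measurable measurableSet_Ioi _)]
  exact ENNReal.mul_lt_top (ENNReal.mul_lt_top (ENNReal.mul_lt_top ENNReal.ofReal_lt_top ENNReal.ofReal_lt_top) ENNReal.ofReal_lt_top)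
    (lintegral_weight_mul_indicator_lt_rpow_lt_top h2 hc hc1 νG μK νI hBK h𝓕I hβ (by linarith) hT0)

/-! ## §4 ED. 7: the Maass–Selberg relation for flat sections of `U(J₃)` with the four absolute convergences PROVED -/

/-- **THE MAASS–SELBERG RELATION FOR FLAT SECTIONS OF `U(J₃)`, ED. 7** = ★ ED. 6 `maassSelberg_flatSectionU_three_fin` with the four absolute-convergence inputs `hψL1`, `hi₅`,
`habs`, `habs′` DISCHARGED by §3 at `α_t = φ̃ := (M(w₀) f_z)·H^{z−2}`, `α_t′ = φ̃′` (bounded by ★ [D8] `norm_intertwinedCoeff_le`, Borel by ★ ED. 5 `measurable_intertwinedCoeff`) on the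
sub-tube `2 < Re z′ < Re z`, from the binders already present (`hfinz`, `hfinz′`, `‖φ‖ ≤ C_φ`, `‖φ′‖ ≤ C_φ′`, `T ≥ 1`).  Remaining named inputs: `hfinz`∕`hfinz′`∕`hint′`∕`hsum`,
`Λ′ = Λ^T E(f′_{z′})` Borel∕`G(F)`-invariant∕bounded (all ★ at CM), and the `K_U`-average data `hΞ₁…hΞ₄`; conclusion verbatim.
[cite: MoeglinWaldspurger1995, II.1.5–II.1.7 and IV.2.1–IV.2.3] [cite: Arthur1980TraceFormulaII, §4] [cite: Garrett2018, §2.8 and §11.3] -/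
theorem maassSelberg_flatSectionU_three_pair (h2 : Module.finrank F E = 2) (hc : c * c = 1) (hc1 : c ≠ 1)
    (μ : Measure (quasiSplit F E c 3).automorphicQuotient) [(quasiSplit F E c 3).IsAutomorphicMeasure μ]
    (νG : Measure (quasiSplit F E c 3).Adelic) [νG.IsHaarMeasure] [νG.IsInvInvariant]
    (μK : Measure ((standardMaximalCompactGL 3 E).comap (adelicVal F E c 3 ((StdForm.antidiagonal 3).over E)) : Subgroup (quasiSplit F E c 3).Adelic))
    [μK.IsHaarMeasure]
    (νI : Measure (AdeleRing (𝓞 E) E)ˣ) [νI.IsHaarMeasure]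
    (hBK : ∀ g : (quasiSplit F E c 3).Adelic, ∃ b ∈ borelAdelic F E c 3, ∃ k : (quasiSplit F E c 3).Adelic,
      adelicVal F E c 3 ((StdForm.antidiagonal 3).over E) k ∈ standardMaximalCompactGL 3 E ∧ g = b * k)
    {𝓕I : Set (AdeleRing (𝓞 E) E)ˣ} (h𝓕I : IsIdeleClassDomain E 𝓕I)
    (ν : Measure ↥(adelicUnipotent F E c 3)) [ν.IsHaarMeasure] [ν.IsInvInvariant]
    {𝓕 : Set ↥(adelicUnipotent F E c 3)} (h𝓕N : IsFundamentalDomain ↥(rationalUnipotent F E c 3) 𝓕 ν) (h𝓕1 : ν 𝓕 = 1) :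
    ∃ cμ K : ℝ, 0 < cμ ∧ 0 < K ∧
      ∀ {β : (quasiSplit F E c 3).Adelic → ℝ≥0∞}, IsCoveringWeight ((arithmeticBorel F E c 3).map (quasiSplit F E c 3).arithmeticSubgroup.subtype) β →
      ∀ {T : ℝ≥0}, 1 ≤ T →
      ∀ {φ φ' : (quasiSplit F E c 3).Adelic → ℂ},
      Measurable φ →
        (∀ (n : unipotentInBorel F E c 3) (y : (quasiSplit F E c 3).Adelic), φ (((n : borelAdelic F E c 3) : (quasiSplit F E c 3).Adelic) * y) = φ y) →
        (∀ b ∈ arithmeticBorel F E c 3, ∀ y : (quasiSplit F E c 3).Adelic, φ ((b : (quasiSplit F E c 3).Adelic) * y) = φ y) →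
      ∀ {Cφ : ℝ}, (∀ x, ‖φ x‖ ≤ Cφ) →
      Measurable φ' →
        (∀ (n : unipotentInBorel F E c 3) (y : (quasiSplit F E c 3).Adelic), φ' (((n : borelAdelic F E c 3) : (quasiSplit F E c 3).Adelic) * y) = φ' y) →
        (∀ b ∈ arithmeticBorel F E c 3, ∀ y : (quasiSplit F E c 3).Adelic, φ' ((b : (quasiSplit F E c 3).Adelic) * y) = φ' y) →
      ∀ {Cφ' : ℝ}, (∀ x, ‖φ' x‖ ≤ Cφ') →
      ∀ {z z' : ℂ}, 2 < z'.re → z'.re < z.re →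
      -- NAMED: the Godement finiteness of the standard sections `H^z`, `H^{z′}` in ★ R3's spelling (★ `hfin_of_locallyUniformMajorant` + ★ R4a at CM) — it now ALSO bounds `φ̃`, `φ̃′` (§5)
        (∀ g : (quasiSplit F E c 3).Adelic, ∫⁻ u in 𝓕, (∑' q : (quasiSplit F E c 3).quotientSubgroup ⧸ (borelAdelic F E c 3).subgroupOf (quasiSplit F E c 3).quotientSubgroup,
            ‖flatSectionU (fun _ : (quasiSplit F E c 3).Adelic => (1 : ℂ)) z ((((q.out : (quasiSplit F E c 3).quotientSubgroup) : (quasiSplit F E c 3).Adelic))⁻¹ * (u : (quasiSplit F E c 3).Adelic) * g)‖ₑ) ∂ν < ∞) →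
        (∀ g : (quasiSplit F E c 3).Adelic, ∫⁻ u in 𝓕, (∑' q : (quasiSplit F E c 3).quotientSubgroup ⧸ (borelAdelic F E c 3).subgroupOf (quasiSplit F E c 3).quotientSubgroup,
            ‖flatSectionU (fun _ : (quasiSplit F E c 3).Adelic => (1 : ℂ)) z' ((((q.out : (quasiSplit F E c 3).quotientSubgroup) : (quasiSplit F E c 3).Adelic))⁻¹ * (u : (quasiSplit F E c 3).Adelic) * g)‖ₑ) ∂ν < ∞) →
        (∀ g : (quasiSplit F E c 3).Adelic,
          Summable fun q : Quotient (orbitRel ↥(borelU (c : E →+* E) ((StdForm.antidiagonal 3).over E)) ↥(unitaryGroupOfForm (c : E →+* E) ((StdForm.antidiagonal 3).over E))) =>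
            flatSectionU φ z ((quasiSplit F E c 3).toAdelic (q.out : ↥(unitaryGroupOfForm (c : E →+* E) ((StdForm.antidiagonal 3).over E))) * g)) →
      -- the truncated second series `Λ′ := Λ^T E(f′_{z′})`: Borel, `G(F)`-invariant, bounded (★ R6e ∕ p857707 at CM), and its Eisenstein series integrable along `N(F)∖N(𝔸)·g` (R4a)
        Measurable (truncation ν 𝓕 T (eisensteinSeriesU (flatSectionU φ' z'))) →
        (∀ (γ : (quasiSplit F E c 3).arithmeticSubgroup) (x : (quasiSplit F E c 3).Adelic), truncation ν 𝓕 T (eisensteinSeriesU (flatSectionU φ' z')) ((γ : (quasiSplit F E c 3).Adelic) * x) = truncation ν 𝓕 T (eisensteinSeriesU (flatSectionU φ' z')) x) →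
        ∀ {M₁ : ℝ}, (∀ g, ‖truncation ν 𝓕 T (eisensteinSeriesU (flatSectionU φ' z')) g‖ ≤ M₁) →
        (∀ g : (quasiSplit F E c 3).Adelic, IntegrableOn (fun u : ↥(adelicUnipotent F E c 3) => eisensteinSeriesU (flatSectionU φ' z') ((u : (quasiSplit F E c 3).Adelic) * g)) 𝓕 ν) →
      ∀ {Ξ₁ Ξ₂ Ξ₃ Ξ₄ : (AdeleRing (𝓞 E) E)ˣ → ℂ},
      Measurable Ξ₁ → ∀ {CΞ₁ : ℝ}, (∀ x, ‖Ξ₁ x‖ ≤ CΞ₁) → (∀ k ∈ GaloisRepresentations.principalIdeles E, ∀ x, Ξ₁ (k * x) = Ξ₁ x) →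
        (∀ (r : ℝ≥0ˣ) (x : (AdeleRing (𝓞 E) E)ˣ), Ξ₁ (posRealIdele E r * x) = Ξ₁ x) →
        (∀ t : torusInBorel F E c 3,
          ∫ k, φ (((t : borelAdelic F E c 3) : (quasiSplit F E c 3).Adelic) * (k : (quasiSplit F E c 3).Adelic)) *
              conj (φ' (((t : borelAdelic F E c 3) : (quasiSplit F E c 3).Adelic) * (k : (quasiSplit F E c 3).Adelic))) ∂μK = Ξ₁ (diagUnit (t : borelAdelic F E c 3).2 0)) →
      Measurable Ξ₂ → ∀ {CΞ₂ : ℝ}, (∀ x, ‖Ξ₂ x‖ ≤ CΞ₂) → (∀ k ∈ GaloisRepresentations.principalIdeles E, ∀ x, Ξ₂ (k * x) = Ξ₂ x) →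
        (∀ (r : ℝ≥0ˣ) (x : (AdeleRing (𝓞 E) E)ˣ), Ξ₂ (posRealIdele E r * x) = Ξ₂ x) →
        (∀ t : torusInBorel F E c 3,
          ∫ k, φ (((t : borelAdelic F E c 3) : (quasiSplit F E c 3).Adelic) * (k : (quasiSplit F E c 3).Adelic)) *
              conj ((fun g : (quasiSplit F E c 3).Adelic => (∫ v : ↥(adelicUnipotent F E c 3), flatSectionU φ' z' ((quasiSplit F E c 3).toAdelic (weylLongU (c : E →+* E) (rfl : (StdForm.antidiagonal 3).over E = (StdForm.antidiagonal 3).over E)) * ((v : (quasiSplit F E c 3).Adelic) * g)) ∂ν) * ((borelHeight g : ℝ) : ℂ) ^ (z' - 2)) (((t : borelAdelic F E c 3) : (quasiSplit F E c 3).Adelic) * (k : (quasiSplit F E c 3).Adelic))) ∂μK = Ξ₂ (diagUnit (t : borelAdelic F E c 3).2 0)) →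
      Measurable Ξ₃ → ∀ {CΞ₃ : ℝ}, (∀ x, ‖Ξ₃ x‖ ≤ CΞ₃) → (∀ k ∈ GaloisRepresentations.principalIdeles E, ∀ x, Ξ₃ (k * x) = Ξ₃ x) →
        (∀ (r : ℝ≥0ˣ) (x : (AdeleRing (𝓞 E) E)ˣ), Ξ₃ (posRealIdele E r * x) = Ξ₃ x) →
        (∀ t : torusInBorel F E c 3,
          ∫ k, (fun g : (quasiSplit F E c 3).Adelic => (∫ v : ↥(adelicUnipotent F E c 3), flatSectionU φ z ((quasiSplit F E c 3).toAdelic (weylLongU (c : E →+* E) (rfl : (StdForm.antidiagonal 3).over E = (StdForm.antidiagonal 3).over E)) * ((v : (quasiSplit F E c 3).Adelic) * g)) ∂ν) * ((borelHeight g : ℝ) : ℂ) ^ (z - 2)) (((t : borelAdelic F E c 3) : (quasiSplit F E c 3).Adelic) * (k : (quasiSplit F E c 3).Adelic)) *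
              conj (φ' (((t : borelAdelic F E c 3) : (quasiSplit F E c 3).Adelic) * (k : (quasiSplit F E c 3).Adelic))) ∂μK = Ξ₃ (diagUnit (t : borelAdelic F E c 3).2 0)) →
      Measurable Ξ₄ → ∀ {CΞ₄ : ℝ}, (∀ x, ‖Ξ₄ x‖ ≤ CΞ₄) → (∀ k ∈ GaloisRepresentations.principalIdeles E, ∀ x, Ξ₄ (k * x) = Ξ₄ x) →
        (∀ (r : ℝ≥0ˣ) (x : (AdeleRing (𝓞 E) E)ˣ), Ξ₄ (posRealIdele E r * x) = Ξ₄ x) →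
        (∀ t : torusInBorel F E c 3,
          ∫ k, (fun g : (quasiSplit F E c 3).Adelic => (∫ v : ↥(adelicUnipotent F E c 3), flatSectionU φ z ((quasiSplit F E c 3).toAdelic (weylLongU (c : E →+* E) (rfl : (StdForm.antidiagonal 3).over E = (StdForm.antidiagonal 3).over E)) * ((v : (quasiSplit F E c 3).Adelic) * g)) ∂ν) * ((borelHeight g : ℝ) : ℂ) ^ (z - 2)) (((t : borelAdelic F E c 3) : (quasiSplit F E c 3).Adelic) * (k : (quasiSplit F E c 3).Adelic)) *
              conj ((fun g : (quasiSplit F E c 3).Adelic => (∫ v : ↥(adelicUnipotent F E c 3), flatSectionU φ' z' ((quasiSplit F E c 3).toAdelic (weylLongU (c : E →+* E) (rfl : (StdForm.antidiagonal 3).over E = (StdForm.antidiagonal 3).over E)) * ((v : (quasiSplit F E c 3).Adelic) * g)) ∂ν) * ((borelHeight g : ℝ) : ℂ) ^ (z' - 2)) (((t : borelAdelic F E c 3) : (quasiSplit F E c 3).Adelic) * (k : (quasiSplit F E c 3).Adelic))) ∂μK = Ξ₄ (diagUnit (t : borelAdelic F E c 3).2 0)) →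
        ∫ x, (quasiSplit F E c 3).quotFun (truncation ν 𝓕 T (eisensteinSeriesU (flatSectionU φ z))) x * conj ((quasiSplit F E c 3).quotFun (truncation ν 𝓕 T (eisensteinSeriesU (flatSectionU φ' z'))) x) ∂μ =
          (cμ : ℂ) * ((K : ℂ) *
            ((((T : ℝ) : ℂ) ^ (z + conj z' - 2) / (z + conj z' - 2)) * (∫ x in {x : (AdeleRing (𝓞 E) E)ˣ | (IdeleClassGroup.ideleNorm E x : ℝ) ≤ 1} ∩ 𝓕I, ((IdeleClassGroup.ideleNorm E x : ℝ) : ℂ) * Ξ₁ x ∂νI)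
              + (((T : ℝ) : ℂ) ^ (z - conj z') / (z - conj z')) * (∫ x in {x : (AdeleRing (𝓞 E) E)ˣ | (IdeleClassGroup.ideleNorm E x : ℝ) ≤ 1} ∩ 𝓕I, ((IdeleClassGroup.ideleNorm E x : ℝ) : ℂ) * Ξ₂ x ∂νI)
              - (((T : ℝ) : ℂ) ^ (-(z - conj z')) / (z - conj z')) * (∫ x in {x : (AdeleRing (𝓞 E) E)ˣ | (IdeleClassGroup.ideleNorm E x : ℝ) ≤ 1} ∩ 𝓕I, ((IdeleClassGroup.ideleNorm E x : ℝ) : ℂ) * Ξ₃ x ∂νI)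
              - (((T : ℝ) : ℂ) ^ (-(z + conj z' - 2)) / (z + conj z' - 2)) * (∫ x in {x : (AdeleRing (𝓞 E) E)ˣ | (IdeleClassGroup.ideleNorm E x : ℝ) ≤ 1} ∩ 𝓕I, ((IdeleClassGroup.ideleNorm E x : ℝ) : ℂ) * Ξ₄ x ∂νI))) := by
  obtain ⟨cμ, K, hcμ, hK, h6⟩ := maassSelberg_flatSectionU_three_fin h2 hc hc1 μ νG μK νI hBK h𝓕I ν h𝓕N h𝓕1
  refine ⟨cμ, K, hcμ, hK, ?_⟩
  intro β hβ T hT φ φ' hφm hφN hφB Cφ hφC hφ'm hφ'N hφ'B Cφ' hφ'C z z' hz' hzz' hfinz hfinz' hsum hΛm hΛG M₁ hΛbdd hint'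
    Ξ₁ Ξ₂ Ξ₃ Ξ₄ hΞ₁m CΞ₁ hΞ₁C hΞ₁K hΞ₁M hΞ₁ hΞ₂m CΞ₂ hΞ₂C hΞ₂K hΞ₂M hΞ₂ hΞ₃m CΞ₃ hΞ₃C hΞ₃K hΞ₃M hΞ₃ hΞ₄m CΞ₄ hΞ₄C hΞ₄K hΞ₄M hΞ₄
  have hT0 : 0 < T := lt_of_lt_of_le one_pos hT
  have hz : 2 < z.re := hz'.trans hzz'
  -- the intertwined coefficients `φ̃`, `φ̃′`: bounded by `C_φ·c(Re z)`, `C_φ′·c(Re z′)` (★ [D8] §5) and Borel (★ ED. 5 §1)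
  have hφtC := fun x => norm_intertwinedCoeff_le hc hc1 ν hBK h𝓕N hφC z x (hfinz x)
  have hφt'C := fun x => norm_intertwinedCoeff_le hc hc1 ν hBK h𝓕N hφ'C z' x (hfinz' x)
  have hφtm := measurable_intertwinedCoeff ν hφm z (z - 2)
  have hφt'm := measurable_intertwinedCoeff ν hφ'm z' (z' - 2)
  exact h6 hβ hT hφm hφN hφB hφC hφ'm hφ'N hφ'B hφ'C hz' hzz' hfinz hfinz' hsum hΛm hΛG hΛbdd hint'
    (lintegral_weight_mul_enorm_psi_lt_top h2 hc hc1 νG μK νI hBK h𝓕I hβ hT0 hφC hφtC hz)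
    (integrable_weight_smul_psi_mul_conj_integral_chi h2 hc hc1 νG μK νI hBK h𝓕I ν h𝓕N hβ hT0 hφm hφtm hφ'm hφt'm hφC hφtC hφ'C hφt'C hz' hzz' hfinz')
    (lintegral_weight_mul_lintegral_chi_weyl_mul_conj_psi_lt_top h2 hc hc1 νG μK νI hBK h𝓕I ν h𝓕N hβ hT0 hφC hφtC hφ'C hφt'C hz' hzz' hfinz')
    (lintegral_weight_mul_lintegral_chi_mul_conj_psi_weylInv_lt_top h2 hc hc1 νG μK νI hBK h𝓕I ν h𝓕N hβ hT _ hφC hφ'C hφt'C hz' hzz' hfinz)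
    hΞ₁m hΞ₁C hΞ₁K hΞ₁M hΞ₁ hΞ₂m hΞ₂C hΞ₂K hΞ₂M hΞ₂ hΞ₃m hΞ₃C hΞ₃K hΞ₃M hΞ₃ hΞ₄m hΞ₄C hΞ₄K hΞ₄M hΞ₄

end Summit.HodgeConjecture.HodgeConjecture.Cruxes.H413.K2E1MaassSelbergCMThreePairingsFin

end
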